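import Summits.QuantumFields.Balaban3D.Proofs.Transport48

/-!
# `Summit.QuantumFields.Balaban3D.Proofs.TransportAC` — the transport algebra of (48)–(49) of [Balaban1985UV3] pp. 267–268 under
# ABSOLUTE CONTINUITY ONLY (`Carriers.AvgAC`: `Ū` measurable and `Ū_*(dU) ≪ dV`), i.e. WITHOUT Haar compatibility `Ū_*(dU) = dV`
# — lane `pub-balaban3d`, seat alpha-1 (definition request `defn-AlphaInputsT3AC` of route `UnitScaleTilt`, cell ym3-torus)

WHY.  The lane's step leaf `…Proofs.Transport48.transport41_le_sum_ae` ((48)–(49) dV-a.e.) is stated for a HAAR-COMPATIBLE averaging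
(`hmap : (dU).map Ū = dV`), but its proof uses `hmap` only to obtain `AvgAC Ū` in its first line: monotonicity and additivity of the
Radon–Nikodym transport `T = rnTransport Ū` (`rnTransport_mono_ae`, `rnTransport_sum_ae`) are theorems under `AvgAC`.  Haar compatibility
is load-bearing in the lane only through the hypothesis `hm₁` («the transported weighted masses are below the next masses»), i.e. through
`T1 = 1` for the `[0,1]`-pinned masses of `Carriers.Masses`.  For an averaging that is merely absolutely continuous — the block averaging
`BlockAveraging.blockAvg ℰp` of the T³ family of route `UnitScaleTilt` (tree: `T3UnitLawDensityEML.haarAC_blockAvg`; exact Haar-ness is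
NOT in print, [Balaban1985Averaging] (10) p. 19 being only the `V`-integral normalisation, and fails for non-abelian `G` beyond forests,
cell ym-nodeO-ideate P2 reading) — the transport step (48)–(49) goes through VERBATIM once the masses are the exact (uncapped) transports
(`…Proofs.MassesAC`).  This file is that step.

WHAT THIS FILE PROVES ([folklore] measure theory over LQB `AveragingRT.rnTransport` and seat p4's `RTAlgebra`; nothing of CMP 102 asserted):
* `transport41_le_sum_ae_of_ac` — (48)–(49) dV-a.e. under `AvgAC`: same statement and proof as `Transport48.transport41_le_sum_ae` with
  `(hac : AvgAC avg)` in place of `havg`/`hmap`;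
* `rnTransport_mono_ae_of_ae_le` — `T` is monotone a.e. on integrable NON-NEGATIVE densities compared only a.e. (`ρ₁ ≤ᵐ ρ₂`), by
  `Carriers.rnTransport_congr_ae` + `rnTransport_mono_ae`;
* `integrable_mul_exp_of_le` — an INTEGRABLE weight times `exp` of a measurable exponent bounded above is integrable (the `hint` of the step
  leaves for UNBOUNDED masses; `Transport48.integrable_weight_mul_exp` asked `m ≤ 1`).
-/

noncomputable section

namespace Summit.QuantumFields.Balaban3D.Proofs.TransportAC

open _root_.MeasureTheory
open Literature.MathematicalPhysics.QuantumFieldTheory.Balaban1983to89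
open Literature.MathematicalPhysics.QuantumFieldTheory.Balaban1983to89.AveragingRT (rnTransport rnTransport_nonneg)
open Summit.QuantumFields.Balaban3D.Carriers (AvgAC isRT_rnTransport_of_ac integrable_rnTransport measurable_rnTransport
  rnTransport_congr_ae)
open Summit.QuantumFields.Balaban3D.Proofs.RTAlgebra
open Summit.QuantumFields.Balaban3D.Proofs.Transport48 (integrable_of_bounds rnTransport_mono_ae rnTransport_sum_ae integrable_weight_mul)

variable {P : Params} {j : ℕ} {G : Type*} [GaugeGroup G] [MeasurableSpace G] [HaarData G]
  {avg : GaugeField P j G → GaugeField P (j + 1) G}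

/-! ## §1 Two auxiliary facts -/

/-- **`T` is monotone dV-a.e. under an a.e. comparison** of non-negative integrable densities: `ρ₁ ≤ᵐ ρ₂ ⇒ Tρ₁ ≤ᵐ Tρ₂` — the transport of
`ρ₁` is the transport of `min ρ₁ ρ₂` (same dU-class, `Carriers.rnTransport_congr_ae`), which is pointwise below `ρ₂`. [folklore] -/
theorem rnTransport_mono_ae_of_ae_le (h : AvgAC avg) {ρ₁ ρ₂ : Density P j G} (h0₁ : ∀ U, 0 ≤ ρ₁ U) (h0₂ : ∀ U, 0 ≤ ρ₂ U)
    (hle : ρ₁ ≤ᵐ[fieldMeasure P j G] ρ₂)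
    (hi₁ : Integrable ρ₁ (fieldMeasure P j G)) (hi₂ : Integrable ρ₂ (fieldMeasure P j G)) :
    rnTransport avg ρ₁ ≤ᵐ[fieldMeasure P (j + 1) G] rnTransport avg ρ₂ := by
  have hmin : ρ₁ =ᵐ[fieldMeasure P j G] fun U => min (ρ₁ U) (ρ₂ U) := by
    filter_upwards [hle] with U hU
    exact (min_eq_left hU).symm
  have hcongr : rnTransport avg ρ₁ = rnTransport avg fun U => min (ρ₁ U) (ρ₂ U) :=
    rnTransport_congr_ae hmin h0₁ fun U => le_min (h0₁ U) (h0₂ U)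
  rw [hcongr]
  exact rnTransport_mono_ae h (fun U => min_le_right _ _) (hi₁.congr hmin) hi₂

/-- **`hint` FOR UNBOUNDED MASSES**: an integrable weight `m` times `exp F`, `F` measurable and bounded above by `c`, is integrable
(`‖exp F‖ ≤ exp c`, `Integrable.mul_bdd`). [folklore] -/
theorem integrable_mul_exp_of_le {k : ℕ} {m F : Density P k G} (hm : Integrable m (fieldMeasure P k G)) (hF : Measurable F)
    {c : ℝ} (hFc : ∀ U, F U ≤ c) : Integrable (fun U => m U * Real.exp (F U)) (fieldMeasure P k G) :=
  hm.mul_bdd (Real.measurable_exp.comp hF).aestronglyMeasurable (c := Real.exp c)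
    (Filter.Eventually.of_forall fun U => by
      rw [Real.norm_eq_abs, abs_of_pos (Real.exp_pos _)]
      exact Real.exp_le_exp.mpr (hFc U))

/-! ## §2 (48)–(49) dV-a.e. under `AvgAC` -/

section Main

variable {H₀ H₁ : Type*} [Fintype H₀] [Fintype H₁]

/-- **(48)–(49) dV-a.e. UNDER ABSOLUTE CONTINUITY** ([Balaban1985UV3] p. 267 L33–p. 268 L13, the lane's reading R-RN/R-48/D-41′; the
statement of `Transport48.transport41_le_sum_ae` with `AvgAC Ū` in place of measurability + Haar compatibility).  Fine lattice `j`, old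
histories `H₀`, new histories `H₁` with `proj`; `ρ` integrable with (41)_k `ρ ≤ Σ_h m₀(h)·e^{F₀(h)}` (`h41`, integrable summands `hint`,
`m₀ ≥ 0`); step weights `w h′ ∈ [0,1]` and small-field factors `χB h′ ∈ [0,1]`, measurable, with SOME new history above `h` of full weight
wherever `m₀(h) ≠ 0` (`hcover`); new masses dominating the transported weighted old ones `T[w(h′)·m₀(proj h′)] ≤ m₁(h′)` a.e. (`hm₁` —
for the exact transports of `…Proofs.MassesAC` this holds with NO hypothesis on `Ū`); `B ≥ 0`; and per new history THE FIBRE INEQUALITY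
`hfibre` («The integral (49)» ≤ the (55)·(58) factor, the (β) content, not proved here).  THEN `Tρ ≤ Σ_{h′} m₁(h′)·B(h′)` dV-a.e.
[cite: Balaban1985UV3, (48)–(49) pp.267–268] -/
theorem transport41_le_sum_ae_of_ac (hac : AvgAC avg)
    (proj : H₁ → H₀) (ρ : Density P j G) (hρ : Integrable ρ (fieldMeasure P j G))
    (m₀ : H₀ → Density P j G) (F₀ : H₀ → GaugeField P j G → ℝ)
    (w χB : H₁ → Density P j G) (m₁ B : H₁ → Density P (j + 1) G)
    (h41 : ∀ U, ρ U ≤ ∑ h, m₀ h U * Real.exp (F₀ h U))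
    (hint : ∀ h, Integrable (fun U => m₀ h U * Real.exp (F₀ h U)) (fieldMeasure P j G))
    (hm₀0 : ∀ h U, 0 ≤ m₀ h U)
    (hw : ∀ h', Measurable (w h')) (hw0 : ∀ h' U, 0 ≤ w h' U) (hw1 : ∀ h' U, w h' U ≤ 1)
    (hχ : ∀ h', Measurable (χB h')) (hχ0 : ∀ h' U, 0 ≤ χB h' U) (hχ1 : ∀ h' U, χB h' U ≤ 1)
    (hcover : ∀ h U, m₀ h U ≠ 0 → ∃ h', proj h' = h ∧ (1 : ℝ) ≤ w h' U * χB h' U)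
    (hm₁ : ∀ h', (rnTransport avg fun U => w h' U * m₀ (proj h') U) ≤ᵐ[fieldMeasure P (j + 1) G] m₁ h')
    (hB : ∀ h' V, 0 ≤ B h' V)
    (hfibre : ∀ h', (rnTransport avg (fun U => w h' U * χB h' U * (m₀ (proj h') U * Real.exp (F₀ (proj h') U))))
      ≤ᵐ[fieldMeasure P (j + 1) G] fun V => rnTransport avg (fun U => w h' U * m₀ (proj h') U) V * B h' V) :
    rnTransport avg ρ ≤ᵐ[fieldMeasure P (j + 1) G] fun V => ∑ h', m₁ h' V * B h' V := by
  classical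
  -- the summands of (41)_k and their refinements over the new histories
  set R : Density P j G := fun U => ∑ h, m₀ h U * Real.exp (F₀ h U) with hR
  set g : H₁ → Density P j G := fun h' U => w h' U * χB h' U * (m₀ (proj h') U * Real.exp (F₀ (proj h') U)) with hg
  have hRi : Integrable R (fieldMeasure P j G) := integrable_finsetSum _ fun h _ => hint h
  have hgi : ∀ h', Integrable (g h') (fieldMeasure P j G) := fun h' =>
    integrable_weight_mul (hw h') (hχ h') (hw0 h') (hw1 h') (hχ0 h') (hχ1 h') (hint (proj h'))
  have hg0 : ∀ h' U, 0 ≤ g h' U := fun h' U =>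
    mul_nonneg (mul_nonneg (hw0 h' U) (hχ0 h' U)) (mul_nonneg (hm₀0 _ U) (Real.exp_pos _).le)
  -- Step A: `Tρ ≤ T R` a.e.
  have hA : rnTransport avg ρ ≤ᵐ[fieldMeasure P (j + 1) G] rnTransport avg R := rnTransport_mono_ae hac h41 hρ hRi
  -- Step B: `T R = Σ_h T(m₀ h e^{F₀ h})` a.e.
  have hBsum : rnTransport avg R =ᵐ[fieldMeasure P (j + 1) G]
      fun V => ∑ h, rnTransport avg (fun U => m₀ h U * Real.exp (F₀ h U)) V :=
    rnTransport_sum_ae hac Finset.univ (fun h U => m₀ h U * Real.exp (F₀ h U)) fun h _ => hint h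
  -- Step C: for each old history, insert the decomposition of unity and transport
  have hC : ∀ h, rnTransport avg (fun U => m₀ h U * Real.exp (F₀ h U)) ≤ᵐ[fieldMeasure P (j + 1) G]
      rnTransport avg (fun U => ∑ h' ∈ Finset.univ.filter (fun h' => proj h' = h), g h' U) := fun h => by
    refine rnTransport_mono_ae hac (fun U => ?_) (hint h) (integrable_finsetSum _ fun h' _ => hgi h')
    by_cases hm : m₀ h U = 0
    · rw [hm, zero_mul]; exact Finset.sum_nonneg fun h' _ => hg0 h' U
    · have hpos : 0 ≤ m₀ h U * Real.exp (F₀ h U) := mul_nonneg (hm₀0 h U) (Real.exp_pos _).le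
      have hsum : ∑ h' ∈ Finset.univ.filter (fun h' => proj h' = h), g h' U
          = (∑ h' ∈ Finset.univ.filter (fun h' => proj h' = h), w h' U * χB h' U) * (m₀ h U * Real.exp (F₀ h U)) := by
        rw [Finset.sum_mul]
        refine Finset.sum_congr rfl fun h' hh' => ?_
        rw [Finset.mem_filter] at hh'
        rw [hg]; simp only [hh'.2]
      rw [hsum]
      obtain ⟨h₁, hh₁, hone⟩ := hcover h U hm
      have hcov : (1 : ℝ) ≤ ∑ h' ∈ Finset.univ.filter (fun h' => proj h' = h), w h' U * χB h' U :=
        hone.trans (Finset.single_le_sum (f := fun h' => w h' U * χB h' U)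
          (fun h' _ => mul_nonneg (hw0 h' U) (hχ0 h' U)) (Finset.mem_filter.mpr ⟨Finset.mem_univ _, hh₁⟩))
      calc m₀ h U * Real.exp (F₀ h U) = 1 * (m₀ h U * Real.exp (F₀ h U)) := (one_mul _).symm
        _ ≤ _ := mul_le_mul_of_nonneg_right hcov hpos
  -- Step D: split the transported refined sum
  have hD : ∀ h, rnTransport avg (fun U => ∑ h' ∈ Finset.univ.filter (fun h' => proj h' = h), g h' U)
      =ᵐ[fieldMeasure P (j + 1) G] fun V => ∑ h' ∈ Finset.univ.filter (fun h' => proj h' = h), rnTransport avg (g h') V :=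
    fun h => rnTransport_sum_ae hac _ g fun h' _ => hgi h'
  -- gather the finitely many a.e. statements
  have hC' := ae_all_iff.mpr hC
  have hD' := ae_all_iff.mpr hD
  have hE' := ae_all_iff.mpr hfibre
  have hF' := ae_all_iff.mpr hm₁
  filter_upwards [hA, hBsum, hC', hD', hE', hF'] with V hA hBsum hC hD hE hF
  calc rnTransport avg ρ V ≤ rnTransport avg R V := hA
    _ = ∑ h, rnTransport avg (fun U => m₀ h U * Real.exp (F₀ h U)) V := hBsum
    _ ≤ ∑ h, ∑ h' ∈ Finset.univ.filter (fun h' => proj h' = h), rnTransport avg (g h') V :=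
        Finset.sum_le_sum fun h _ => (hC h).trans (le_of_eq (hD h))
    _ ≤ ∑ h, ∑ h' ∈ Finset.univ.filter (fun h' => proj h' = h), m₁ h' V * B h' V := by
        refine Finset.sum_le_sum fun h _ => Finset.sum_le_sum fun h' _ => ?_
        calc rnTransport avg (g h') V ≤ rnTransport avg (fun U => w h' U * m₀ (proj h') U) V * B h' V := hE h'
          _ ≤ m₁ h' V * B h' V := mul_le_mul_of_nonneg_right (hF h') (hB h' V)
    _ = ∑ h', m₁ h' V * B h' V := Finset.sum_fiberwise Finset.univ proj fun h' => m₁ h' V * B h' V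

end Main

end Summit.QuantumFields.Balaban3D.Proofs.TransportAC

end
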